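import Literature.MathematicalPhysics.QuantumFieldTheory.Balaban1983to89.B9Eq3112
import Literature.MathematicalPhysics.QuantumFieldTheory.Balaban1983to89.B10SectCExpansion

/-!
# `Balaban1983to89.B10Eq54QuadForm` — T. Bałaban, *Ultraviolet stability of three-dimensional lattice pure gauge
field theories*, Commun. Math. Phys. **102** (1985) 255–275 [Balaban1985UV3], display **(54)** p. 269:
«For the quadratic form above we have ½⟨H₁A, Δ₁H₁A⟩ − ⟨H₁D̃⁽²⁾(A), J⟩ = ½⟨A, Δ_kA⟩, (54) where Δ_k was defined
by (3.156) in [5], and investigated in Sect. E of that paper.» — DERIVED in the finite-dimensional dictionary of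
[5] Sect. D–E built by the cell (`B9SectDFP`, `B9Eq3152`, `B9Eq3112`): with `Δ_k` DEFINED by [5] (3.156), (54) is
[5] (3.128) + [7] (79) evaluated at the minimiser `H₁` of [5] (3.127)/(3.110) (row `B10.Eq54` of the B10 skeleton;
r07's abstract leaf `B10SectCExpansion.QuadForm54` INHABITED on the concrete carrier)

statement-level skeleton of published theorems with citation tags; proofs where landed; nothing here is a claim about
the Yang–Mills mass gap

SOURCES (all HELD; displays read on the x2 renders under
`run/shared/lean/pub/pub-balaban/b2b-balaban-ref1/pages/…`, the Euclid text layers being unreliable for displays):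
* [B10] = [Balaban1985UV3] p. 269 (`1985-cmp102-uv-stability-3d-p015-x2.png`; `paper:balaban1985-cmp102-uv-stability-3d`
  p0015), (53) third member «= A^η(U_{k+1}) + ½⟨H₁A, Δ₁H₁A⟩ − ⟨H₁D̃⁽²⁾(A), J⟩ + {⋯}» and (54) as quoted above;
  p. 269: «the expansion (26), Eq. (174), and the formulas (74), (78)–(81) of [7]».
* [5] = T. Bałaban, *Propagators for lattice gauge theories in a background field*, Commun. Math. Phys. **99** (1985)
  389–434 [Balaban1985BackgroundPropagators] (`paper:balaban1985-cmp99-background-propagators`):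
  p. 421 (`…-p033-x2.png`) «Let us write a quadratic form replacing (3.109) in the variational problem.
  A → ½⟨A, ΔA⟩ − ⟨HC⁽²⁾(A), J⟩. (3.127) … Let us denote the operator defined by the problem (3.127), (3.110) by H₁,
  and by G₁ the operator defined by the quadratic form ⟨A, G₁⁻¹A⟩ = ⟨A, Δ_πA⟩ − 2⟨HC_π⁽²⁾(A), J⟩ + ‖RD*A‖² + a‖QA‖²
  = … (3.128) Then we have the formula H₁B = G₁Q*(QG₁Q*)⁻¹B. (3.129)»;
  p. 427 (`…-p039-x2.png`) «e^{½⟨g, C^{(k)}(Λ)g⟩} = (Z^{(k)}(Λ))⁻¹ ∫dB↾_Λ δ(Q₁B)δ_{Ax}(B) · exp[−½⟨H₁B, G₁⁻¹H₁B⟩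
  + ½a⟨B, B⟩ + ⟨H₁D̃⁽²⁾(B), J⟩ + ⟨B, g⟩], (3.155) where … the function D̃⁽²⁾(B) is a quadratic polynomial in B with
  properties similar to C⁽²⁾(A), only restricted to unit blocks»;
  p. 428 (`…-p040-x2.png`) «The quadratic form in the above integral can be written also as
  ⟨B, (QG₁Q*)⁻¹B⟩ − a⟨B, B⟩ − 2⟨H₁D̃⁽²⁾(B), J⟩ = ⟨B, Δ_kB⟩. (3.156)».
* [7] = T. Bałaban, *The variational problem and background fields in renormalization group method for lattice gauge
  theories*, Commun. Math. Phys. **102** (1985) 277–309 [Balaban1985Variational]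
  (`paper:balaban1985-cmp102-variational-background`), p. 290 (`1985-cmp102-variational-background-p014-x2.png`):
  «⟨HD(A′), J⟩ = ⟨HC⁽²⁾(A′), J⟩ + ⟨HD₃(A′), J⟩. (78) Thus a quadratic form in the expansion of 𝔉(A′) is equal to
  ½⟨A′, Δ_πA′⟩ − ⟨HC⁽²⁾(A′), J⟩ = ½⟨A′, Δ_πA′⟩ − ½⟨A′, Δ_π⁽²⁾A′⟩ = ½⟨A′, Δ₁A′⟩, (79) where we have used again the
  fact that A′ satisfy the Landau gauge condition RD*A′ = 0.» and «𝔉(A′) = A(U₀) + ⟨A′, J⟩ + ½⟨A′, Δ₁A′⟩ + V(A′)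
  (81)».

CITATION HEADER.  WHAT IS REPRODUCED: row `B10.Eq54` of SKELETON block B10
(`run/shared/lean/pub/lit-balaban/lit-balaban-r07/ROWS-B10.md` §1), typed since gen 1 as the hypothesis-shaped leaf
`B10SectCExpansion.QuadForm54` (p238811; `quadForm54_unique` proved there: (54) determines `Δ_k` among symmetric
operators).  Unit `lit-balaban-r07` (fold owner of B10), gen 33.  WHAT THE TREE HAD: the cell pub-balaban's
finite-dimensional reading of [5] Sect. D ((3.109)–(3.112), (3.118)–(3.129)) and of the Gaussian representation
(3.155)–(3.159): `B9SectDFP` (`T = 1 − DG′RD*`, `Δ_π = TᵀKT`, `G⁻¹ = Δ_π + DRD* + Q*aQ`), `B9Eq3152` (`G₁⁻¹` of (3.128)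
as `G1inv K C = Ginv (K − 2C)`, `C` the matrix of `A ↦ ⟨HC⁽²⁾(A), J⟩`; (3.129)), `B9Eq3112` (the minimiser `H` of the
double-constraint problem (3.109)–(3.110) as `hOp`, `hOp_feasible`, `H_eq_3126`, and `min_3109_value`:
`⟨HB, K·HB⟩ = ⟨B, (Q_bGQ_bᵀ)⁻¹B⟩ − a⟨B, B⟩` — «the first step of (3.156)»).  The `J`-dependent term of (3.156) and the
identity (54) itself were in no file (`B9Eq3112` header: «the `J`-dependent terms of (3.155)–(3.156) are not treated
here»).  THIS FILE adds exactly that bookkeeping, by name from those files — nothing of [5] Sect. D is re-derived.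

DICTIONARY (every «↦» is a reading of print; index types and matrices as in `B9Eq3112`: `n` sites, `m` blocks
(`Q : m × n`, kernel basis `N : n × τ`), `b` bonds (`D : b × n`, `DᵀD = Δ` the site Laplacian inside `R`, `G′`), `q`
block-bond variables (`Qb : q × b` = print's `Q` on bond fields, (3.115) `Q_bD = D̄Q`), `K : b × b` = the bond form
written `Δ(U_{k+1})` in (53) / `Δ` in (3.109), (3.127); `R = B9H163.R Δ Q a`):
* `C : b × b` ↦ the matrix of the quadratic form `A′ ↦ ⟨HC⁽²⁾(A′), J⟩` of (78)/(3.127) (fixed `J`; the cell's letter,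
  `B9Eq3152.G1inv`);  `Δ_π⁽²⁾ ↦ 2·Tᵀ C T` (the operator with `½⟨A′, Δ_π⁽²⁾A′⟩ = ⟨HC⁽²⁾(TA′), J⟩ = ⟨HC_π⁽²⁾(A′), J⟩`,
  first line of (3.128));
* **`Δ₁ ↦ delta1 K C Δ Q a D := Δ_π − 2·Tᵀ C T`** ((79): `½⟨A′, Δ_πA′⟩ − ½⟨A′, Δ_π⁽²⁾A′⟩ = ½⟨A′, Δ₁A′⟩`), so that
  (3.128) reads `G₁⁻¹ = Δ₁ + DRD* + Q*aQ` (`G1inv_eq_delta1`);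
* **`H₁ ↦ h1Op K C Δ N D Qb := hOp (K − 2C) Δ N D Qb`**, the minimiser of `½⟨A, (K − 2C)A⟩` = (3.127) on the
  hyperplane (3.110) (`= G₁Q_bᵀ(Q_bG₁Q_bᵀ)⁻¹` = (3.129) by `B9Eq3112.H_eq_3126`, recorded as `h1Op_eq_3129`);
* `E : q × q` ↦ the matrix of the quadratic form `B ↦ ⟨H₁D̃⁽²⁾(B), J⟩` of (3.155)/(3.156)/(54) («D̃⁽²⁾(B) is a quadratic
  polynomial in B», fixed `J`) — the same move as the cell's `C`;
* **`Δ_k ↦ deltaK K C Δ Q a D Qb ab E := (Q_bG₁Q_bᵀ)⁻¹ − a·1 − (E + Eᵀ)`** = THE DEFINITION (3.156) (symmetrised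
  `J`-term, so that `Δ_k` is symmetric, `deltaK_transpose`; the quadratic form is (3.156) verbatim, `eq_3156`).

WHAT THIS FILE PROVES (kernel, 0 sorry, standard axioms; no named `Prop` fact introduced):
* §1 `G1inv_eq_delta1` ((3.128) ⇔ `G₁⁻¹ = Δ₁ + DRD* + a·Q_bᵀQ_b`), **`eq79_gaugeFixed`** (on `{RD*A′ = 0}`:
  `⟨A′, Δ₁A′⟩ = ⟨A′, KA′⟩ − 2⟨A′, CA′⟩` — the middle member of (79)), `eq_3156` (the definition, verbatim),
  `deltaK_transpose`.
* §2 **`eq54_of79`**: for ANY `Δ1` with the (79) form on `{RD*A′ = 0}`, `½⟨H₁A, Δ1·H₁A⟩ − ⟨A, EA⟩ = ½⟨A, Δ_kA⟩` for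
  EVERY `A : q → ℝ`, under the nonsingularity hypotheses of `B9Eq3112.min_3109_value` (bordered matrix of
  `(K − 2C, S)`, `G₁⁻¹`, `Q_bG₁Q_bᵀ`); **`eq54`** = the instance `Δ1 = delta1`; **`eq54_of79_of_Δa`** / **`eq54_of_Δa`**:
  the same with those three DISCHARGED from the print's positivity input `Δ_a(K − 2C) = K − 2C + DRD* + a·Q_bᵀQ_b > 0`
  ((3.111) p. 417 at the form (3.127)) and a kernel basis of `S`, exactly as `B9Eq3112.H_eq_3126` does;
  `h1Op_feasible`, `h1Op_eq_3129`.
* §3 THE BRIDGE to r07's abstract leaf: **`quadForm54_of_matrix`** — for every `d : ExpansionData (EuclideanSpace ℝ q)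
  (EuclideanSpace ℝ b)` whose `H₁`, `Δ₁` are the Euclidean operators of matrices `H`, `Δ1` and whose `J`-term is the
  quadratic form of `E` (`⟪H₁(D̃⁽²⁾A), J⟫ = ⟨A, EA⟩`), a matrix identity of the shape (54) gives
  `QuadForm54 d (toEuclideanLin Δk)`; **`quadForm54_b9`** / **`quadForm54_b9_of_Δa`**: instantiated at the dictionary
  above — `QuadForm54 d (toEuclideanLin (deltaK …))`, i.e. (54) HOLDS with `Δ_k` := (3.156); `deltaK_eq_of_quadForm54`:
  conversely every symmetric operator satisfying (54) for such `d` IS `toEuclideanLin (deltaK …)`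
  (`B10SectCExpansion.quadForm54_unique`).
* §4 (v1.1, append-only) THE TWO SECT.-D IDENTITIES that `B12Eq15QuadraticForm.Data.eq15_eq_B9_3156` ([Balaban1987RG1]
  (1.5)/(2.11) = «the definition (3.156) [13] with the δ-function gauge fixing term replaced by the exponential one») takes
  as HYPOTHESES, now BY NAME in the dictionary: `G1inv_quadForm_gaugeFixed` / **`G1inv_quadForm_h1Op`** (its `hG`:
  `⟨H₁B, G₁⁻¹H₁B⟩ = ⟨H₁B, Δ₁H₁B⟩ + a⟨B, B⟩`) and **`h1Op_energy`** (its `h3156`: `⟨H₁B, G₁⁻¹H₁B⟩ = ⟨B, (QG₁Q*)⁻¹B⟩`,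
  = the cell's `eq_3156_energy` at `K − 2C`); and **`exponent55_b9`**: p. 269 «Denoting the expression in curly brackets
  {⋯} in (53) by Ṽ(A) … we obtain (55)» — the exponent `A^η(U_k(⋯)) = A^η(U_{k+1}) + ½⟨A, Δ_kA⟩ + Ṽ(A)` on the
  concrete carrier with `Δ_k` := (3.156) (r07's `expansion53_54` fed by `quadForm54_b9_of_Δa`; the third member of
  (53) is the input).

VERSIONS.  v1 = p333649 (gen 33).  v1.1 (gen 33) = v1 verbatim + §4 (theorems only; no declaration of v1 changed).

HONEST SCOPE.  (i) (54) is certified as finite-dimensional linear algebra over the cell's [5]-dictionary: the letters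
`H₁`, `Δ₁`, `G₁`, `Δ_k` are the MATRICES above at a fixed background, not the operators of [5]/[7] as functions of
`U_{k+1}`; the identifications «Δ₁ of (53) = the (79)/(81) operator of [7] = the bond-form part `Δ_π − 2𝒞_π` of
(3.128)» and «H₁ of (53) = the operator of (3.127)/(3.110) = (3.129)» are READINGS (print p. 269 cites exactly
(74), (78)–(81) of [7] and (3.155)–(3.156) of [5] for these letters).  (ii) The two `J`-quadratic forms
`⟨HC⁽²⁾(·), J⟩`, `⟨H₁D̃⁽²⁾(·), J⟩` enter through their matrices `C`, `E` only (fixed `J`); that they ARE quadratic forms is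
print ((78): `C⁽²⁾` «second order term»; (3.155): «quadratic polynomial in B»).  (iii) No bound, no positivity
`Δ_k ≥ γ₀` (that is [5] Sect. E / `B9SectEKernel`), no locality.  (iv) The sign conventions of [5] pp. 424–425
((3.134)–(3.138), `Δ + Δ⁽²⁾` in (3.159) vs `Δ − Δ⁽²⁾`) recorded by the cell (GAPS G-adv7-4) are immaterial here: `C` is
an arbitrary matrix.  (v) Non-vacuity of the hypothesis set = that of `B9Eq3112` (its recorded exact toy check, GAPS
C-B9-77, is the case `C = 0`, `E = 0`).  Located bookkeeping; NOT summit progress (not continuum, not Clay).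
-/

namespace Literature.MathematicalPhysics.QuantumFieldTheory.Balaban1983to89.B10Eq54QuadForm

open Matrix
open scoped Matrix RealInnerProductSpace
open Literature.MathematicalPhysics.QuantumFieldTheory.Balaban1983to89.Beta.Composition (kkt)
open Literature.MathematicalPhysics.QuantumFieldTheory.Balaban1983to89.Beta.CompositionSingular
open Literature.MathematicalPhysics.QuantumFieldTheory.Balaban1983to89.B9SectDFP (tOp piOp Ginv)
open Literature.MathematicalPhysics.QuantumFieldTheory.Balaban1983to89.B9Eq3112 (dcon hOp)
open Literature.MathematicalPhysics.QuantumFieldTheory.Balaban1983to89.B9Eq3152 (G1inv)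

/-! ## §0  Two dot-product helpers -/

section Helpers

variable {ι : Type*} [Fintype ι]

/-- `⟨v, Mᵀv⟩ = ⟨v, Mv⟩`. [folklore] -/
private theorem dotProduct_transpose_mulVec_self (M : Matrix ι ι ℝ) (v : ι → ℝ) :
    v ⬝ᵥ Mᵀ *ᵥ v = v ⬝ᵥ M *ᵥ v := by
  rw [mulVec_transpose, dotProduct_comm, ← dotProduct_mulVec]

/-- `⟨v, (M + Mᵀ)v⟩ = 2⟨v, Mv⟩`. [folklore] -/
private theorem dotProduct_add_transpose_mulVec_self (M : Matrix ι ι ℝ) (v : ι → ℝ) :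
    v ⬝ᵥ (M + Mᵀ) *ᵥ v = 2 * (v ⬝ᵥ M *ᵥ v) := by
  rw [add_mulVec, dotProduct_add, dotProduct_transpose_mulVec_self, two_mul]

end Helpers

/-! ## §1  The dictionary: `Δ₁` of [7] (79)/(81), `H₁` of [5] (3.127)–(3.129), `Δ_k` of [5] (3.156) -/

section Dictionary

variable {n m τ b q : Type*}

/-- **`Δ₁` of (53)–(54)** = the operator of the quadratic form (79)/(81) of [7]: `Δ₁ := Δ_π − Δ_π⁽²⁾` with
`Δ_π = TᵀKT` ((3.119) of [5], `B9SectDFP.piOp`) and `Δ_π⁽²⁾ := 2·TᵀCT`, `C` the matrix of `A′ ↦ ⟨HC⁽²⁾(A′), J⟩`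
(so `½⟨A′, Δ_π⁽²⁾A′⟩ = ⟨HC⁽²⁾(TA′), J⟩ = ⟨HC_π⁽²⁾(A′), J⟩`, first line of (3.128) of [5]).
[cite: Balaban1985Variational, (79) p.290] [cite: Balaban1985UV3, (53)-(54) p.269] -/
noncomputable def delta1 [Fintype n] [Fintype m] [Fintype b] [DecidableEq n] [DecidableEq m] [DecidableEq b]
    (K C : Matrix b b ℝ) (Δ : Matrix n n ℝ) (Q : Matrix m n ℝ) (a : ℝ) (D : Matrix b n ℝ) : Matrix b b ℝ :=
  piOp K Δ Q a D - (2 : ℝ) • piOp C Δ Q a D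

/-- **(3.128) of [5] in the letter `Δ₁`**: `G₁⁻¹ = Δ₁ + DRD* + a·Q_bᵀQ_b` (the cell's `G1inv K C = Ginv (K − 2C)`,
`B9Eq3152.G1inv_eq`). [cite: Balaban1985BackgroundPropagators, (3.128) p.421] -/
theorem G1inv_eq_delta1 [Fintype n] [Fintype m] [Fintype b] [Fintype q] [DecidableEq n] [DecidableEq m]
    [DecidableEq b] (K C : Matrix b b ℝ) (Δ : Matrix n n ℝ) (Q : Matrix m n ℝ) (a : ℝ) (D : Matrix b n ℝ)
    (Qb : Matrix q b ℝ) (ab : ℝ) :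
    G1inv K C Δ Q a D Qb ab = delta1 K C Δ Q a D + D * B9H163.R Δ Q a * Dᵀ + ab • (Qbᵀ * Qb) := by
  rw [B9Eq3152.G1inv_eq, delta1]

/-- **(79) of [7], middle member, on the Landau-gauge fields**: if `RD*A′ = 0` then
`⟨A′, Δ₁A′⟩ = ⟨A′, KA′⟩ − 2⟨A′, CA′⟩` (= `⟨A′, Δ_πA′⟩ − 2⟨HC⁽²⁾(A′), J⟩` in print's letters: `TA′ = A′` on
`{RD*A′ = 0}`, `B9SectDFP.tOp_mulVec`, and `⟨A′, TᵀMTA′⟩ = ⟨TA′, M·TA′⟩`, `B9SectDFP.piOp_quadForm`) — «where we have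
used again the fact that A′ satisfy the Landau gauge condition RD*A′ = 0». [cite: Balaban1985Variational, (79) p.290] -/
theorem eq79_gaugeFixed [Fintype n] [Fintype m] [Fintype b] [DecidableEq n] [DecidableEq m] [DecidableEq b]
    (K C : Matrix b b ℝ) (Δ : Matrix n n ℝ) (Q : Matrix m n ℝ) (a : ℝ) (D : Matrix b n ℝ) (A : b → ℝ)
    (hRA : B9H163.R Δ Q a *ᵥ (Dᵀ *ᵥ A) = 0) :
    A ⬝ᵥ delta1 K C Δ Q a D *ᵥ A = A ⬝ᵥ K *ᵥ A - 2 * (A ⬝ᵥ C *ᵥ A) := by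
  have hT : tOp Δ Q a D *ᵥ A = A := by
    rw [B9SectDFP.tOp_mulVec, hRA, mulVec_zero, mulVec_zero, sub_zero]
  rw [delta1, sub_mulVec, dotProduct_sub, Matrix.smul_mulVec, dotProduct_smul, smul_eq_mul,
    B9SectDFP.piOp_quadForm, B9SectDFP.piOp_quadForm, hT]

/-- **`H₁` of (53)–(54), (3.155)–(3.156)** = «the operator defined by the problem (3.127), (3.110)» ([5] p. 421): the
cell's `B9Eq3112.hOp` at the bond form `K − 2C` — the critical point of `½⟨A, (K − 2C)A⟩` (= (3.127),
`½⟨A, KA⟩ − ⟨HC⁽²⁾(A), J⟩`) on the hyperplane (3.110) `Q_bA = B`, `RD*A = 0` (for symmetric `K`, `C` and `Δ_a > 0` its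
unique minimiser, `B9Eq3112.eq_3109_min`; `= G₁Q_bᵀ(Q_bG₁Q_bᵀ)⁻¹` = (3.129), `h1Op_eq_3129`).
[cite: Balaban1985BackgroundPropagators, (3.127) p.421, (3.110)-(3.111) p.417] -/
noncomputable def h1Op [Fintype n] [Fintype τ] [Fintype b] [Fintype q] [DecidableEq τ] [DecidableEq b]
    [DecidableEq q] (K C : Matrix b b ℝ) (Δ : Matrix n n ℝ) (N : Matrix n τ ℝ) (D : Matrix b n ℝ)
    (Qb : Matrix q b ℝ) : Matrix b q ℝ :=
  hOp (K - (2 : ℝ) • C) Δ N D Qb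

/-- **`Δ_k`, DEFINED BY (3.156) of [5]**: the symmetric matrix of the quadratic form
`⟨B, (QG₁Q*)⁻¹B⟩ − a⟨B, B⟩ − 2⟨H₁D̃⁽²⁾(B), J⟩`, `E` the matrix of `B ↦ ⟨H₁D̃⁽²⁾(B), J⟩` (the `J`-term symmetrised as
`E + Eᵀ`; `G₁ = (G1inv …)⁻¹`, `a ↦ ab`).  This is the `Δ_k` of B10 (54) («where Δ_k was defined by (3.156) in [5]»).
[cite: Balaban1985BackgroundPropagators, (3.156) p.428] [cite: Balaban1985UV3, (54) p.269] -/
noncomputable def deltaK [Fintype n] [Fintype m] [Fintype b] [Fintype q] [DecidableEq n] [DecidableEq m]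
    [DecidableEq b] [DecidableEq q] (K C : Matrix b b ℝ) (Δ : Matrix n n ℝ) (Q : Matrix m n ℝ) (a : ℝ)
    (D : Matrix b n ℝ) (Qb : Matrix q b ℝ) (ab : ℝ) (E : Matrix q q ℝ) : Matrix q q ℝ :=
  (Qb * (G1inv K C Δ Q a D Qb ab)⁻¹ * Qbᵀ)⁻¹ - ab • (1 : Matrix q q ℝ) - (E + Eᵀ)

/-- **(3.156) of [5], verbatim**: `⟨B, (QG₁Q*)⁻¹B⟩ − a⟨B, B⟩ − 2⟨H₁D̃⁽²⁾(B), J⟩ = ⟨B, Δ_kB⟩` — with `Δ_k := deltaK …`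
this is the definition unfolded (`⟨B, (E + Eᵀ)B⟩ = 2⟨B, EB⟩`). [cite: Balaban1985BackgroundPropagators, (3.156) p.428] -/
theorem eq_3156 [Fintype n] [Fintype m] [Fintype b] [Fintype q] [DecidableEq n] [DecidableEq m] [DecidableEq b]
    [DecidableEq q] (K C : Matrix b b ℝ) (Δ : Matrix n n ℝ) (Q : Matrix m n ℝ) (a : ℝ) (D : Matrix b n ℝ)
    (Qb : Matrix q b ℝ) (ab : ℝ) (E : Matrix q q ℝ) (B : q → ℝ) :
    B ⬝ᵥ (Qb * (G1inv K C Δ Q a D Qb ab)⁻¹ * Qbᵀ)⁻¹ *ᵥ B - ab * (B ⬝ᵥ B) - 2 * (B ⬝ᵥ E *ᵥ B) =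
      B ⬝ᵥ deltaK K C Δ Q a D Qb ab E *ᵥ B := by
  rw [deltaK, sub_mulVec, sub_mulVec, dotProduct_sub, dotProduct_sub, Matrix.smul_mulVec, one_mulVec,
    dotProduct_smul, smul_eq_mul, dotProduct_add_transpose_mulVec_self]

/-- `Δ_k` is symmetric whenever `G₁⁻¹` is (e.g. `K`, `C` symmetric: `B9SectDFP.Ginv_transpose` at `K − 2C`).
[cite: Balaban1985BackgroundPropagators, (3.156) p.428] -/
theorem deltaK_transpose [Fintype n] [Fintype m] [Fintype b] [Fintype q] [DecidableEq n] [DecidableEq m]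
    [DecidableEq b] [DecidableEq q] (K C : Matrix b b ℝ) (Δ : Matrix n n ℝ) (Q : Matrix m n ℝ) (a : ℝ)
    (D : Matrix b n ℝ) (Qb : Matrix q b ℝ) (ab : ℝ) (E : Matrix q q ℝ)
    (hG : (G1inv K C Δ Q a D Qb ab)ᵀ = G1inv K C Δ Q a D Qb ab) :
    (deltaK K C Δ Q a D Qb ab E)ᵀ = deltaK K C Δ Q a D Qb ab E := by
  have h1 : ((G1inv K C Δ Q a D Qb ab)⁻¹)ᵀ = (G1inv K C Δ Q a D Qb ab)⁻¹ := by
    rw [transpose_nonsing_inv, hG]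
  have h2 : (Qb * (G1inv K C Δ Q a D Qb ab)⁻¹ * Qbᵀ)ᵀ = Qb * (G1inv K C Δ Q a D Qb ab)⁻¹ * Qbᵀ := by
    rw [transpose_mul, transpose_mul, transpose_transpose, h1, Matrix.mul_assoc]
  rw [deltaK, transpose_sub, transpose_sub, transpose_nonsing_inv, h2, transpose_smul, transpose_one,
    transpose_add, transpose_transpose, add_comm Eᵀ E]

/-- `G₁⁻¹` is symmetric for symmetric `K`, `C` (and symmetric site Laplacian `Δ`) — the cell's `Ginv_transpose` at
`K − 2C`. [cite: Balaban1985BackgroundPropagators, (3.128) p.421] -/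
theorem G1inv_transpose [Fintype n] [Fintype m] [Fintype b] [Fintype q] [DecidableEq n] [DecidableEq m]
    [DecidableEq b] (K C : Matrix b b ℝ) (hK : Kᵀ = K) (hC : Cᵀ = C) (Δ : Matrix n n ℝ) (Q : Matrix m n ℝ)
    (a : ℝ) (hΔ : Δ.IsSymm) (D : Matrix b n ℝ) (Qb : Matrix q b ℝ) (ab : ℝ) :
    (G1inv K C Δ Q a D Qb ab)ᵀ = G1inv K C Δ Q a D Qb ab := by
  have hKC : (K - (2 : ℝ) • C)ᵀ = K - (2 : ℝ) • C := by rw [transpose_sub, transpose_smul, hK, hC]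
  exact B9SectDFP.Ginv_transpose (K - (2 : ℝ) • C) hKC Δ Q a hΔ D Qb ab

end Dictionary

/-! ## §2  (54): `½⟨H₁A, Δ₁H₁A⟩ − ⟨H₁D̃⁽²⁾(A), J⟩ = ½⟨A, Δ_kA⟩` -/

section Eq54

variable {n m τ b q σ : Type*}

/-- `H₁A` lies on the hyperplane (3.110): `Q_b(H₁A) = A` and `RD*(H₁A) = 0` (the cell's `hOp_feasible` at `K − 2C`).
[cite: Balaban1985BackgroundPropagators, (3.110) p.417, (3.127) p.421] -/
theorem h1Op_feasible [Fintype n] [Fintype m] [Fintype τ] [Fintype b] [Fintype q] [DecidableEq n]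
    [DecidableEq m] [DecidableEq τ] [DecidableEq b] [DecidableEq q] (e : n ≃ τ ⊕ m) (K C : Matrix b b ℝ)
    (Δ : Matrix n n ℝ) (Q : Matrix m n ℝ) (a : ℝ) (hΔ : Δ.IsSymm) (hΔ' : IsUnit (B9H163.Δ' Δ Q a))
    (N : Matrix n τ ℝ) (hQN : Q * N = 0) (hQM : IsUnit (Q * Qᵀ).det) (hTs : IsUnit (Nᵀ * (Δ * Δ) * N).det)
    (D : Matrix b n ℝ) (Qb : Matrix q b ℝ) (hW : IsUnit (kkt (K - (2 : ℝ) • C) (dcon Δ N D Qb)).det)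
    (A : q → ℝ) :
    Qb *ᵥ (h1Op K C Δ N D Qb *ᵥ A) = A ∧ B9H163.R Δ Q a *ᵥ (Dᵀ *ᵥ (h1Op K C Δ N D Qb *ᵥ A)) = 0 :=
  B9Eq3112.hOp_feasible e (K - (2 : ℝ) • C) Δ Q a hΔ hΔ' N hQN hQM hTs D Qb hW A

/-- **(54) p. 269 [Balaban1985UV3] FROM (79) AS PRINT STATES IT** — for ANY operator `Δ1` whose quadratic form on
the Landau-gauge fields `{RD*A′ = 0}` is `⟨A′, KA′⟩ − 2⟨A′, CA′⟩` (the middle member of (79) of [7]; instance: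
`delta1`, `eq79_gaugeFixed`): `½⟨H₁A, Δ1·H₁A⟩ − ⟨H₁D̃⁽²⁾(A), J⟩ = ½⟨A, Δ_kA⟩` for every block-bond field `A`, with `Δ_k`
DEFINED by (3.156) of [5].  PROOF (print's «where Δ_k was defined by (3.156) in [5]» unfolded): `H₁A` is in the Landau
gauge and averages to `A` (`h1Op_feasible`), so by (79) `⟨H₁A, Δ1·H₁A⟩ = ⟨H₁A, (K − 2C)H₁A⟩`, which is the value of
(3.127) at its critical point on (3.110), `= ⟨A, (Q_bG₁Q_bᵀ)⁻¹A⟩ − a⟨A, A⟩` by (3.111) + «the first step of (3.156)»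
(the cell's `B9Eq3112.min_3109_value` at `K − 2C`); subtract `2⟨H₁D̃⁽²⁾(A), J⟩ = 2⟨A, EA⟩` and halve: (3.156).
Hypotheses = those of `min_3109_value` (the bordered matrix of `(K − 2C, S)`, `G₁⁻¹` and `Q_bG₁Q_bᵀ` nonsingular;
(3.115) `Q_bD = D̄Q`; kernel basis `N` of `Q`); discharged from `Δ_a > 0` in `eq54_of_Δa`.
[cite: Balaban1985UV3, (54) p.269] [cite: Balaban1985Variational, (79) p.290]
[cite: Balaban1985BackgroundPropagators, (3.156) p.428, (3.128) p.421] -/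
theorem eq54_of79 [Fintype n] [Fintype m] [Fintype τ] [Fintype b] [Fintype q] [DecidableEq n] [DecidableEq m]
    [DecidableEq τ] [DecidableEq b] [DecidableEq q] (e : n ≃ τ ⊕ m) (K C : Matrix b b ℝ) (Δ : Matrix n n ℝ)
    (Q : Matrix m n ℝ) (a : ℝ) (hΔ : Δ.IsSymm) (hΔ' : IsUnit (B9H163.Δ' Δ Q a)) (N : Matrix n τ ℝ)
    (hQN : Q * N = 0) (hQM : IsUnit (Q * Qᵀ).det) (hTs : IsUnit (Nᵀ * (Δ * Δ) * N).det) (D : Matrix b n ℝ)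
    (hD : Dᵀ * D = Δ) (Qb : Matrix q b ℝ) (Dbar : Matrix q m ℝ) (h115 : Qb * D = Dbar * Q) (ab : ℝ)
    (hW : IsUnit (kkt (K - (2 : ℝ) • C) (dcon Δ N D Qb)).det) (hG : IsUnit (G1inv K C Δ Q a D Qb ab).det)
    (hP : IsUnit (Qb * (G1inv K C Δ Q a D Qb ab)⁻¹ * Qbᵀ).det) (Δ1 : Matrix b b ℝ)
    (h79 : ∀ A' : b → ℝ, B9H163.R Δ Q a *ᵥ (Dᵀ *ᵥ A') = 0 →
      A' ⬝ᵥ Δ1 *ᵥ A' = A' ⬝ᵥ K *ᵥ A' - 2 * (A' ⬝ᵥ C *ᵥ A'))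
    (E : Matrix q q ℝ) (A : q → ℝ) :
    (1 / 2 : ℝ) * ((h1Op K C Δ N D Qb *ᵥ A) ⬝ᵥ Δ1 *ᵥ (h1Op K C Δ N D Qb *ᵥ A)) - A ⬝ᵥ E *ᵥ A =
      (1 / 2 : ℝ) * (A ⬝ᵥ deltaK K C Δ Q a D Qb ab E *ᵥ A) := by
  have hfeas := h1Op_feasible e K C Δ Q a hΔ hΔ' N hQN hQM hTs D Qb hW A
  have h79A := h79 (h1Op K C Δ N D Qb *ᵥ A) hfeas.2
  have hmin := B9Eq3112.min_3109_value e (K - (2 : ℝ) • C) Δ Q a hΔ hΔ' N hQN hQM hTs D hD Qb Dbar h115 ab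
    hW hG hP A
  have hKC : (h1Op K C Δ N D Qb *ᵥ A) ⬝ᵥ (K - (2 : ℝ) • C) *ᵥ (h1Op K C Δ N D Qb *ᵥ A) =
      (h1Op K C Δ N D Qb *ᵥ A) ⬝ᵥ K *ᵥ (h1Op K C Δ N D Qb *ᵥ A)
        - 2 * ((h1Op K C Δ N D Qb *ᵥ A) ⬝ᵥ C *ᵥ (h1Op K C Δ N D Qb *ᵥ A)) := by
    rw [sub_mulVec, dotProduct_sub, Matrix.smul_mulVec, dotProduct_smul, smul_eq_mul]
  rw [h1Op] at h79A hKC ⊢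
  rw [hKC] at hmin
  rw [h79A, hmin, ← eq_3156 K C Δ Q a D Qb ab E A, G1inv]
  ring

/-- **(54) p. 269 [Balaban1985UV3]** at the dictionary's `Δ₁ = Δ_π − 2·TᵀCT` (`delta1`; (79) supplied by
`eq79_gaugeFixed`): `½⟨H₁A, Δ₁H₁A⟩ − ⟨H₁D̃⁽²⁾(A), J⟩ = ½⟨A, Δ_kA⟩`, `Δ_k` := (3.156).
[cite: Balaban1985UV3, (54) p.269] [cite: Balaban1985BackgroundPropagators, (3.156) p.428, (3.128) p.421] -/
theorem eq54 [Fintype n] [Fintype m] [Fintype τ] [Fintype b] [Fintype q] [DecidableEq n] [DecidableEq m]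
    [DecidableEq τ] [DecidableEq b] [DecidableEq q] (e : n ≃ τ ⊕ m) (K C : Matrix b b ℝ) (Δ : Matrix n n ℝ)
    (Q : Matrix m n ℝ) (a : ℝ) (hΔ : Δ.IsSymm) (hΔ' : IsUnit (B9H163.Δ' Δ Q a)) (N : Matrix n τ ℝ)
    (hQN : Q * N = 0) (hQM : IsUnit (Q * Qᵀ).det) (hTs : IsUnit (Nᵀ * (Δ * Δ) * N).det) (D : Matrix b n ℝ)
    (hD : Dᵀ * D = Δ) (Qb : Matrix q b ℝ) (Dbar : Matrix q m ℝ) (h115 : Qb * D = Dbar * Q) (ab : ℝ)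
    (hW : IsUnit (kkt (K - (2 : ℝ) • C) (dcon Δ N D Qb)).det) (hG : IsUnit (G1inv K C Δ Q a D Qb ab).det)
    (hP : IsUnit (Qb * (G1inv K C Δ Q a D Qb ab)⁻¹ * Qbᵀ).det) (E : Matrix q q ℝ) (A : q → ℝ) :
    (1 / 2 : ℝ) * ((h1Op K C Δ N D Qb *ᵥ A) ⬝ᵥ delta1 K C Δ Q a D *ᵥ (h1Op K C Δ N D Qb *ᵥ A))
        - A ⬝ᵥ E *ᵥ A =
      (1 / 2 : ℝ) * (A ⬝ᵥ deltaK K C Δ Q a D Qb ab E *ᵥ A) :=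
  eq54_of79 e K C Δ Q a hΔ hΔ' N hQN hQM hTs D hD Qb Dbar h115 ab hW hG hP (delta1 K C Δ Q a D)
    (eq79_gaugeFixed K C Δ Q a D) E A

/-- **(54) FROM (79) AND `Δ_a > 0` ALONE** — the three nonsingularities of `eq54_of79` DISCHARGED as in the cell's
`B9Eq3112.H_eq_3126`: the bordered matrix by `isUnit_kkt_dcon` (kernel basis `N_S` of `S`), `G₁⁻¹ > 0` by
`B9SectDFP.Ginv_posDef_of_Δa` at `K − 2C` (= `B9Eq3152.G1inv_posDef_of_Δa`), `Q_bG₁Q_bᵀ` by `isUnit_det_QHinvQt`; the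
positivity input is the print's `Δ_a = K − 2C + DRD* + a·Q_bᵀQ_b > 0` ((3.111) of [5] at the form (3.127)), `K`, `C`
symmetric. [cite: Balaban1985UV3, (54) p.269] [cite: Balaban1985Variational, (79) p.290]
[cite: Balaban1985BackgroundPropagators, (3.156) p.428, (3.111) p.417] -/
theorem eq54_of79_of_Δa [Fintype n] [Fintype m] [Fintype τ] [Fintype b] [Fintype q] [Fintype σ] [DecidableEq n]
    [DecidableEq m] [DecidableEq τ] [DecidableEq b] [DecidableEq q] [DecidableEq σ] (eS : b ≃ σ ⊕ (q ⊕ τ))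
    (e : n ≃ τ ⊕ m) (K C : Matrix b b ℝ) (hK : Kᵀ = K) (hC : Cᵀ = C) (Δ : Matrix n n ℝ) (Q : Matrix m n ℝ)
    (a : ℝ) (hΔ : Δ.IsSymm) (hΔ' : IsUnit (B9H163.Δ' Δ Q a)) (N : Matrix n τ ℝ) (hQN : Q * N = 0)
    (hQM : IsUnit (Q * Qᵀ).det) (hTs : IsUnit (Nᵀ * (Δ * Δ) * N).det) (D : Matrix b n ℝ) (hD : Dᵀ * D = Δ)
    (Qb : Matrix q b ℝ) (Dbar : Matrix q m ℝ) (h115 : Qb * D = Dbar * Q) (ab : ℝ)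
    (hQbM : IsUnit (Qb * Qbᵀ).det)
    (hΔa : (K - (2 : ℝ) • C + D * B9H163.R Δ Q a * Dᵀ + ab • (Qbᵀ * Qb)).PosDef) (NS : Matrix b σ ℝ)
    (hSN : dcon Δ N D Qb * NS = 0) (hNSA : IsUnit (NSᵀ * NS).det) (Δ1 : Matrix b b ℝ)
    (h79 : ∀ A' : b → ℝ, B9H163.R Δ Q a *ᵥ (Dᵀ *ᵥ A') = 0 →
      A' ⬝ᵥ Δ1 *ᵥ A' = A' ⬝ᵥ K *ᵥ A' - 2 * (A' ⬝ᵥ C *ᵥ A'))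
    (E : Matrix q q ℝ) (A : q → ℝ) :
    (1 / 2 : ℝ) * ((h1Op K C Δ N D Qb *ᵥ A) ⬝ᵥ Δ1 *ᵥ (h1Op K C Δ N D Qb *ᵥ A)) - A ⬝ᵥ E *ᵥ A =
      (1 / 2 : ℝ) * (A ⬝ᵥ deltaK K C Δ Q a D Qb ab E *ᵥ A) := by
  have hKC : (K - (2 : ℝ) • C)ᵀ = K - (2 : ℝ) • C := by rw [transpose_sub, transpose_smul, hK, hC]
  have hM' := B9SectECov.isUnit_M' Δ Q a hΔ hΔ' hQM
  have hpos := B9SectDFP.Ginv_posDef_of_Δa (K - (2 : ℝ) • C) hKC Δ Q a hΔ hΔ' hM' D hD Qb Dbar h115 ab hΔa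
  have hG : IsUnit (G1inv K C Δ Q a D Qb ab).det := (Matrix.isUnit_iff_isUnit_det _).mp hpos.isUnit
  have hP : IsUnit (Qb * (G1inv K C Δ Q a D Qb ab)⁻¹ * Qbᵀ).det :=
    B9Eq3112.isUnit_det_QHinvQt _ hpos Qb hQbM
  have hW := B9Eq3112.isUnit_kkt_dcon eS e (K - (2 : ℝ) • C) hKC Δ Q a hΔ hΔ' N hQN hQM hTs D hD Qb Dbar h115
    ab hQbM hΔa NS hSN hNSA
  exact eq54_of79 e K C Δ Q a hΔ hΔ' N hQN hQM hTs D hD Qb Dbar h115 ab hW hG hP Δ1 h79 E A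

/-- **(54) FROM `Δ_a > 0` ALONE** at the dictionary's `Δ₁` (`delta1`).
[cite: Balaban1985UV3, (54) p.269] [cite: Balaban1985BackgroundPropagators, (3.156) p.428, (3.111) p.417] -/
theorem eq54_of_Δa [Fintype n] [Fintype m] [Fintype τ] [Fintype b] [Fintype q] [Fintype σ] [DecidableEq n]
    [DecidableEq m] [DecidableEq τ] [DecidableEq b] [DecidableEq q] [DecidableEq σ] (eS : b ≃ σ ⊕ (q ⊕ τ))
    (e : n ≃ τ ⊕ m) (K C : Matrix b b ℝ) (hK : Kᵀ = K) (hC : Cᵀ = C) (Δ : Matrix n n ℝ) (Q : Matrix m n ℝ)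
    (a : ℝ) (hΔ : Δ.IsSymm) (hΔ' : IsUnit (B9H163.Δ' Δ Q a)) (N : Matrix n τ ℝ) (hQN : Q * N = 0)
    (hQM : IsUnit (Q * Qᵀ).det) (hTs : IsUnit (Nᵀ * (Δ * Δ) * N).det) (D : Matrix b n ℝ) (hD : Dᵀ * D = Δ)
    (Qb : Matrix q b ℝ) (Dbar : Matrix q m ℝ) (h115 : Qb * D = Dbar * Q) (ab : ℝ)
    (hQbM : IsUnit (Qb * Qbᵀ).det)
    (hΔa : (K - (2 : ℝ) • C + D * B9H163.R Δ Q a * Dᵀ + ab • (Qbᵀ * Qb)).PosDef) (NS : Matrix b σ ℝ)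
    (hSN : dcon Δ N D Qb * NS = 0) (hNSA : IsUnit (NSᵀ * NS).det) (E : Matrix q q ℝ) (A : q → ℝ) :
    (1 / 2 : ℝ) * ((h1Op K C Δ N D Qb *ᵥ A) ⬝ᵥ delta1 K C Δ Q a D *ᵥ (h1Op K C Δ N D Qb *ᵥ A))
        - A ⬝ᵥ E *ᵥ A =
      (1 / 2 : ℝ) * (A ⬝ᵥ deltaK K C Δ Q a D Qb ab E *ᵥ A) :=
  eq54_of79_of_Δa eS e K C hK hC Δ Q a hΔ hΔ' N hQN hQM hTs D hD Qb Dbar h115 ab hQbM hΔa NS hSN hNSA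
    (delta1 K C Δ Q a D) (eq79_gaugeFixed K C Δ Q a D) E A

/-- **(3.129) of [5] for this `H₁`**: `H₁ = G₁Q_bᵀ(Q_bG₁Q_bᵀ)⁻¹` as matrices, from `Δ_a > 0` — the cell's
`B9Eq3112.H_eq_3126` at `K − 2C` (recorded so that the `H₁` of `eq54` is print's (3.129) operator BY NAME).
[cite: Balaban1985BackgroundPropagators, (3.129) p.421, (3.126) p.420] -/
theorem h1Op_eq_3129 [Fintype n] [Fintype m] [Fintype τ] [Fintype b] [Fintype q] [Fintype σ] [DecidableEq n]
    [DecidableEq m] [DecidableEq τ] [DecidableEq b] [DecidableEq q] [DecidableEq σ] (eS : b ≃ σ ⊕ (q ⊕ τ))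
    (e : n ≃ τ ⊕ m) (K C : Matrix b b ℝ) (hK : Kᵀ = K) (hC : Cᵀ = C) (Δ : Matrix n n ℝ) (Q : Matrix m n ℝ)
    (a : ℝ) (hΔ : Δ.IsSymm) (hΔ' : IsUnit (B9H163.Δ' Δ Q a)) (N : Matrix n τ ℝ) (hQN : Q * N = 0)
    (hQM : IsUnit (Q * Qᵀ).det) (hTs : IsUnit (Nᵀ * (Δ * Δ) * N).det) (D : Matrix b n ℝ) (hD : Dᵀ * D = Δ)
    (Qb : Matrix q b ℝ) (Dbar : Matrix q m ℝ) (h115 : Qb * D = Dbar * Q) (ab : ℝ)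
    (hQbM : IsUnit (Qb * Qbᵀ).det)
    (hΔa : (K - (2 : ℝ) • C + D * B9H163.R Δ Q a * Dᵀ + ab • (Qbᵀ * Qb)).PosDef) (NS : Matrix b σ ℝ)
    (hSN : dcon Δ N D Qb * NS = 0) (hNSA : IsUnit (NSᵀ * NS).det) :
    h1Op K C Δ N D Qb =
      (G1inv K C Δ Q a D Qb ab)⁻¹ * Qbᵀ * (Qb * (G1inv K C Δ Q a D Qb ab)⁻¹ * Qbᵀ)⁻¹ := by
  have hKC : (K - (2 : ℝ) • C)ᵀ = K - (2 : ℝ) • C := by rw [transpose_sub, transpose_smul, hK, hC]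
  exact B9Eq3112.H_eq_3126 eS e (K - (2 : ℝ) • C) hKC Δ Q a hΔ hΔ' N hQN hQM hTs D hD Qb Dbar h115 ab hQbM hΔa
    NS hSN hNSA

end Eq54

/-! ## §3  The bridge: r07's abstract leaf `B10SectCExpansion.QuadForm54` INHABITED -/

section Bridge

open B10SectCExpansion (ExpansionData QuadForm54)

variable {q b : Type*} [Fintype q] [Fintype b] [DecidableEq q] [DecidableEq b]

/-- The real inner product of two Euclidean images of matrix–vector products is a dot product. [folklore] -/
private theorem inner_toEuclideanLin (M : Matrix b q ℝ) (M' : Matrix b b ℝ) (A : EuclideanSpace ℝ q) :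
    ⟪Matrix.toEuclideanLin M A, Matrix.toEuclideanLin M' (Matrix.toEuclideanLin M A)⟫ =
      (M *ᵥ WithLp.ofLp A) ⬝ᵥ M' *ᵥ (M *ᵥ WithLp.ofLp A) := by
  rw [EuclideanSpace.inner_eq_star_dotProduct, star_trivial, Matrix.ofLp_toLpLin, Matrix.ofLp_toLpLin,
    Matrix.toLin'_apply, Matrix.toLin'_apply, dotProduct_comm]

/-- Same with a square matrix acting on `A` itself. [folklore] -/
private theorem inner_toEuclideanLin_self (M : Matrix q q ℝ) (A : EuclideanSpace ℝ q) :
    ⟪A, Matrix.toEuclideanLin M A⟫ = WithLp.ofLp A ⬝ᵥ M *ᵥ WithLp.ofLp A := by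
  rw [EuclideanSpace.inner_eq_star_dotProduct, star_trivial, Matrix.ofLp_toLpLin, Matrix.toLin'_apply,
    dotProduct_comm]

/-- **FROM A MATRIX IDENTITY OF THE SHAPE (54) TO THE ABSTRACT LEAF.**  Let `d` be B10 expansion data over the
Euclidean carriers `F = ℝ^q` (block-bond fields `A`), `F′ = ℝ^b` (bond fields), whose linearised minimiser `H₁` and
Hessian-type operator `Δ₁` are the Euclidean operators of matrices `H`, `Δ1`, and whose `J`-pairing of the quadratic
term `D̃⁽²⁾` is the quadratic form of a matrix `E` (`⟪H₁(D̃⁽²⁾A), J⟫ = ⟨A, EA⟩` — [5] (3.155): «D̃⁽²⁾(B) is a quadratic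
polynomial in B»).  If `½⟨HA, Δ1·HA⟩ − ⟨A, EA⟩ = ½⟨A, Δk·A⟩` for all `A`, then `QuadForm54 d (toEuclideanLin Δk)`.
[cite: Balaban1985UV3, (54) p.269] -/
theorem quadForm54_of_matrix (d : ExpansionData (EuclideanSpace ℝ q) (EuclideanSpace ℝ b))
    (H : Matrix b q ℝ) (Δ1 : Matrix b b ℝ) (E Δk : Matrix q q ℝ) (hH : d.H₁ = Matrix.toEuclideanLin H)
    (hΔ1 : d.Δ₁ = Matrix.toEuclideanLin Δ1)
    (hE : ∀ A : EuclideanSpace ℝ q, ⟪d.H₁ (d.D₂ A), d.J⟫ = WithLp.ofLp A ⬝ᵥ E *ᵥ WithLp.ofLp A)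
    (h54 : ∀ A : q → ℝ,
      (1 / 2 : ℝ) * ((H *ᵥ A) ⬝ᵥ Δ1 *ᵥ (H *ᵥ A)) - A ⬝ᵥ E *ᵥ A = (1 / 2 : ℝ) * (A ⬝ᵥ Δk *ᵥ A)) :
    QuadForm54 d (Matrix.toEuclideanLin Δk) := by
  intro A
  rw [hE A, inner_toEuclideanLin_self, ← h54 (WithLp.ofLp A), hH, hΔ1, inner_toEuclideanLin]

variable {n m τ σ : Type*}

/-- **(54) HOLDS, with `Δ_k` := (3.156) of [5], for every B10 expansion data realised by the [5]-dictionary**: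
`H₁ = toEuclideanLin (h1Op …)` (the operator of (3.127)/(3.110), = (3.129)), `Δ₁ = toEuclideanLin Δ1` for any `Δ1`
with the (79) quadratic form `⟨A′, KA′⟩ − 2⟨A′, CA′⟩` on the Landau-gauge fields (instance `delta1`, `eq79_gaugeFixed`),
`⟪H₁(D̃⁽²⁾A), J⟫ = ⟨A, EA⟩`; nonsingularity hypotheses as in `eq54_of79`.  The abstract leaf
`B10SectCExpansion.QuadForm54` (row `B10.Eq54`) is thereby INHABITED on the concrete carrier.
[cite: Balaban1985UV3, (54) p.269] [cite: Balaban1985BackgroundPropagators, (3.156) p.428] -/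
theorem quadForm54_b9 [Fintype n] [Fintype m] [Fintype τ] [DecidableEq n] [DecidableEq m] [DecidableEq τ]
    (e : n ≃ τ ⊕ m) (K C : Matrix b b ℝ) (Δ : Matrix n n ℝ) (Q : Matrix m n ℝ) (a : ℝ) (hΔ : Δ.IsSymm)
    (hΔ' : IsUnit (B9H163.Δ' Δ Q a)) (N : Matrix n τ ℝ) (hQN : Q * N = 0) (hQM : IsUnit (Q * Qᵀ).det)
    (hTs : IsUnit (Nᵀ * (Δ * Δ) * N).det) (D : Matrix b n ℝ) (hD : Dᵀ * D = Δ) (Qb : Matrix q b ℝ)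
    (Dbar : Matrix q m ℝ) (h115 : Qb * D = Dbar * Q) (ab : ℝ)
    (hW : IsUnit (kkt (K - (2 : ℝ) • C) (dcon Δ N D Qb)).det) (hG : IsUnit (G1inv K C Δ Q a D Qb ab).det)
    (hP : IsUnit (Qb * (G1inv K C Δ Q a D Qb ab)⁻¹ * Qbᵀ).det) (Δ1 : Matrix b b ℝ)
    (h79 : ∀ A' : b → ℝ, B9H163.R Δ Q a *ᵥ (Dᵀ *ᵥ A') = 0 →
      A' ⬝ᵥ Δ1 *ᵥ A' = A' ⬝ᵥ K *ᵥ A' - 2 * (A' ⬝ᵥ C *ᵥ A'))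
    (E : Matrix q q ℝ) (d : ExpansionData (EuclideanSpace ℝ q) (EuclideanSpace ℝ b))
    (hH : d.H₁ = Matrix.toEuclideanLin (h1Op K C Δ N D Qb)) (hΔ1 : d.Δ₁ = Matrix.toEuclideanLin Δ1)
    (hE : ∀ A : EuclideanSpace ℝ q, ⟪d.H₁ (d.D₂ A), d.J⟫ = WithLp.ofLp A ⬝ᵥ E *ᵥ WithLp.ofLp A) :
    QuadForm54 d (Matrix.toEuclideanLin (deltaK K C Δ Q a D Qb ab E)) :=
  quadForm54_of_matrix d _ _ E _ hH hΔ1 hE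
    (eq54_of79 e K C Δ Q a hΔ hΔ' N hQN hQM hTs D hD Qb Dbar h115 ab hW hG hP Δ1 h79 E)

/-- **(54) HOLDS (`Δ_k` := (3.156)) FROM `Δ_a > 0` ALONE** — `quadForm54_b9` with the nonsingularities discharged
(`eq54_of_Δa`). [cite: Balaban1985UV3, (54) p.269] [cite: Balaban1985BackgroundPropagators, (3.156) p.428, (3.111) p.417] -/
theorem quadForm54_b9_of_Δa [Fintype n] [Fintype m] [Fintype τ] [Fintype σ] [DecidableEq n] [DecidableEq m]
    [DecidableEq τ] [DecidableEq σ] (eS : b ≃ σ ⊕ (q ⊕ τ)) (e : n ≃ τ ⊕ m) (K C : Matrix b b ℝ) (hK : Kᵀ = K)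
    (hC : Cᵀ = C) (Δ : Matrix n n ℝ) (Q : Matrix m n ℝ) (a : ℝ) (hΔ : Δ.IsSymm)
    (hΔ' : IsUnit (B9H163.Δ' Δ Q a)) (N : Matrix n τ ℝ) (hQN : Q * N = 0) (hQM : IsUnit (Q * Qᵀ).det)
    (hTs : IsUnit (Nᵀ * (Δ * Δ) * N).det) (D : Matrix b n ℝ) (hD : Dᵀ * D = Δ) (Qb : Matrix q b ℝ)
    (Dbar : Matrix q m ℝ) (h115 : Qb * D = Dbar * Q) (ab : ℝ) (hQbM : IsUnit (Qb * Qbᵀ).det)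
    (hΔa : (K - (2 : ℝ) • C + D * B9H163.R Δ Q a * Dᵀ + ab • (Qbᵀ * Qb)).PosDef) (NS : Matrix b σ ℝ)
    (hSN : dcon Δ N D Qb * NS = 0) (hNSA : IsUnit (NSᵀ * NS).det) (Δ1 : Matrix b b ℝ)
    (h79 : ∀ A' : b → ℝ, B9H163.R Δ Q a *ᵥ (Dᵀ *ᵥ A') = 0 →
      A' ⬝ᵥ Δ1 *ᵥ A' = A' ⬝ᵥ K *ᵥ A' - 2 * (A' ⬝ᵥ C *ᵥ A'))
    (E : Matrix q q ℝ) (d : ExpansionData (EuclideanSpace ℝ q) (EuclideanSpace ℝ b))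
    (hH : d.H₁ = Matrix.toEuclideanLin (h1Op K C Δ N D Qb)) (hΔ1 : d.Δ₁ = Matrix.toEuclideanLin Δ1)
    (hE : ∀ A : EuclideanSpace ℝ q, ⟪d.H₁ (d.D₂ A), d.J⟫ = WithLp.ofLp A ⬝ᵥ E *ᵥ WithLp.ofLp A) :
    QuadForm54 d (Matrix.toEuclideanLin (deltaK K C Δ Q a D Qb ab E)) :=
  quadForm54_of_matrix d _ _ E _ hH hΔ1 hE
    (eq54_of79_of_Δa eS e K C hK hC Δ Q a hΔ hΔ' N hQN hQM hTs D hD Qb Dbar h115 ab hQbM hΔa NS hSN hNSA Δ1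
      h79 E)

/-- **CONVERSELY, (54) DETERMINES `Δ_k` AS (3.156)**: for expansion data realised by the dictionary (with `K`, `C`
symmetric, `Δ_a > 0`), every SYMMETRIC operator `Δk′` satisfying (54) is the Euclidean operator of `deltaK …` — r07's
`B10SectCExpansion.quadForm54_unique` (polarization) applied to `quadForm54_b9_of_Δa`; `deltaK …` is symmetric by
`deltaK_transpose` ∘ `G1inv_transpose`.  So print's two descriptions of `Δ_k` on p. 269 — «the quadratic form above»
(54) and «defined by (3.156) in [5]» — name the same operator. [cite: Balaban1985UV3, (54) p.269]
[cite: Balaban1985BackgroundPropagators, (3.156) p.428] -/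
theorem deltaK_eq_of_quadForm54 [Fintype n] [Fintype m] [Fintype τ] [Fintype σ] [DecidableEq n]
    [DecidableEq m] [DecidableEq τ] [DecidableEq σ] (eS : b ≃ σ ⊕ (q ⊕ τ)) (e : n ≃ τ ⊕ m) (K C : Matrix b b ℝ)
    (hK : Kᵀ = K) (hC : Cᵀ = C) (Δ : Matrix n n ℝ) (Q : Matrix m n ℝ) (a : ℝ) (hΔ : Δ.IsSymm)
    (hΔ' : IsUnit (B9H163.Δ' Δ Q a)) (N : Matrix n τ ℝ) (hQN : Q * N = 0) (hQM : IsUnit (Q * Qᵀ).det)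
    (hTs : IsUnit (Nᵀ * (Δ * Δ) * N).det) (D : Matrix b n ℝ) (hD : Dᵀ * D = Δ) (Qb : Matrix q b ℝ)
    (Dbar : Matrix q m ℝ) (h115 : Qb * D = Dbar * Q) (ab : ℝ) (hQbM : IsUnit (Qb * Qbᵀ).det)
    (hΔa : (K - (2 : ℝ) • C + D * B9H163.R Δ Q a * Dᵀ + ab • (Qbᵀ * Qb)).PosDef) (NS : Matrix b σ ℝ)
    (hSN : dcon Δ N D Qb * NS = 0) (hNSA : IsUnit (NSᵀ * NS).det) (Δ1 : Matrix b b ℝ)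
    (h79 : ∀ A' : b → ℝ, B9H163.R Δ Q a *ᵥ (Dᵀ *ᵥ A') = 0 →
      A' ⬝ᵥ Δ1 *ᵥ A' = A' ⬝ᵥ K *ᵥ A' - 2 * (A' ⬝ᵥ C *ᵥ A'))
    (E : Matrix q q ℝ) (d : ExpansionData (EuclideanSpace ℝ q) (EuclideanSpace ℝ b))
    (hH : d.H₁ = Matrix.toEuclideanLin (h1Op K C Δ N D Qb)) (hΔ1 : d.Δ₁ = Matrix.toEuclideanLin Δ1)
    (hE : ∀ A : EuclideanSpace ℝ q, ⟪d.H₁ (d.D₂ A), d.J⟫ = WithLp.ofLp A ⬝ᵥ E *ᵥ WithLp.ofLp A)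
    (Δk' : EuclideanSpace ℝ q →ₗ[ℝ] EuclideanSpace ℝ q) (hsym : Δk'.IsSymmetric) (h54 : QuadForm54 d Δk') :
    Δk' = Matrix.toEuclideanLin (deltaK K C Δ Q a D Qb ab E) := by
  have hKt : (deltaK K C Δ Q a D Qb ab E)ᵀ = deltaK K C Δ Q a D Qb ab E :=
    deltaK_transpose K C Δ Q a D Qb ab E (G1inv_transpose K C hK hC Δ Q a hΔ D Qb ab)
  have hsymK : (Matrix.toEuclideanLin (deltaK K C Δ Q a D Qb ab E)).IsSymmetric := by
    rw [Matrix.isSymmetric_toEuclideanLin_iff]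
    change (deltaK K C Δ Q a D Qb ab E)ᴴ = deltaK K C Δ Q a D Qb ab E
    rw [conjTranspose_eq_transpose_of_trivial, hKt]
  exact B10SectCExpansion.quadForm54_unique d h54
    (quadForm54_b9_of_Δa eS e K C hK hC Δ Q a hΔ hΔ' N hQN hQM hTs D hD Qb Dbar h115 ab hQbM hΔa NS hSN hNSA
      Δ1 h79 E d hH hΔ1 hE) hsym hsymK

end Bridge

/-! ## §4  (v1.1, append-only) The two Sect.-D identities behind (1.5)/(2.11) of [Balaban1987RG1] BY NAME, and the
(55) exponent on the concrete carrier -/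

section SectDIdentities

variable {n m τ b q : Type*}

/-- **`G₁⁻¹ = Δ₁ + DRD* + Q*aQ` ON THE LANDAU-GAUGE FIELDS** ((3.128) of [5] read with (79) of [7]): for `RD*A′ = 0`
and any `Δ1` with the (79) form on the slice, `⟨A′, G₁⁻¹A′⟩ = ⟨A′, Δ1·A′⟩ + a‖Q_bA′‖²` — the cell's
`B9Eq3112.Ginv_quadForm_gaugeFixed` at `K − 2C`. [cite: Balaban1985BackgroundPropagators, (3.128) p.421, (3.111) p.417]
[cite: Balaban1985Variational, (79) p.290] -/
theorem G1inv_quadForm_gaugeFixed [Fintype n] [Fintype m] [Fintype b] [Fintype q] [DecidableEq n] [DecidableEq m]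
    [DecidableEq b] (K C : Matrix b b ℝ) (Δ : Matrix n n ℝ) (Q : Matrix m n ℝ) (a : ℝ) (D : Matrix b n ℝ)
    (Qb : Matrix q b ℝ) (ab : ℝ) (Δ1 : Matrix b b ℝ)
    (h79 : ∀ A' : b → ℝ, B9H163.R Δ Q a *ᵥ (Dᵀ *ᵥ A') = 0 →
      A' ⬝ᵥ Δ1 *ᵥ A' = A' ⬝ᵥ K *ᵥ A' - 2 * (A' ⬝ᵥ C *ᵥ A'))
    (A' : b → ℝ) (hRA : B9H163.R Δ Q a *ᵥ (Dᵀ *ᵥ A') = 0) :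
    A' ⬝ᵥ G1inv K C Δ Q a D Qb ab *ᵥ A' = A' ⬝ᵥ Δ1 *ᵥ A' + ab * ((Qb *ᵥ A') ⬝ᵥ (Qb *ᵥ A')) := by
  have h := B9Eq3112.Ginv_quadForm_gaugeFixed (K - (2 : ℝ) • C) Δ Q a D Qb ab A' hRA
  rw [sub_mulVec, dotProduct_sub, Matrix.smul_mulVec, dotProduct_smul, smul_eq_mul] at h
  rw [G1inv, h, h79 A' hRA]

/-- **THE HYPOTHESIS `hG` OF `B12Eq15QuadraticForm.Data.eq15_eq_B9_3156` DISCHARGED in the dictionary**: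
`⟨H₁B, G₁⁻¹H₁B⟩ = ⟨H₁B, Δ₁H₁B⟩ + a⟨B, B⟩` («`G₁⁻¹ = Δ₁ + DRD* + Q*aQ` on `H₁B`, where `RD*H₁B = 0`, `QH₁B = B`:
[13] (3.124), (3.128)» in that file's words), for any `Δ1` with the (79) form on the Landau-gauge slice.
[cite: Balaban1985BackgroundPropagators, (3.128) p.421, (3.110) p.417] [cite: Balaban1987RG1, (1.5) p.261] -/
theorem G1inv_quadForm_h1Op [Fintype n] [Fintype m] [Fintype τ] [Fintype b] [Fintype q] [DecidableEq n]
    [DecidableEq m] [DecidableEq τ] [DecidableEq b] [DecidableEq q] (e : n ≃ τ ⊕ m) (K C : Matrix b b ℝ)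
    (Δ : Matrix n n ℝ) (Q : Matrix m n ℝ) (a : ℝ) (hΔ : Δ.IsSymm) (hΔ' : IsUnit (B9H163.Δ' Δ Q a))
    (N : Matrix n τ ℝ) (hQN : Q * N = 0) (hQM : IsUnit (Q * Qᵀ).det) (hTs : IsUnit (Nᵀ * (Δ * Δ) * N).det)
    (D : Matrix b n ℝ) (Qb : Matrix q b ℝ) (ab : ℝ) (hW : IsUnit (kkt (K - (2 : ℝ) • C) (dcon Δ N D Qb)).det)
    (Δ1 : Matrix b b ℝ)
    (h79 : ∀ A' : b → ℝ, B9H163.R Δ Q a *ᵥ (Dᵀ *ᵥ A') = 0 →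
      A' ⬝ᵥ Δ1 *ᵥ A' = A' ⬝ᵥ K *ᵥ A' - 2 * (A' ⬝ᵥ C *ᵥ A'))
    (B : q → ℝ) :
    (h1Op K C Δ N D Qb *ᵥ B) ⬝ᵥ G1inv K C Δ Q a D Qb ab *ᵥ (h1Op K C Δ N D Qb *ᵥ B) =
      (h1Op K C Δ N D Qb *ᵥ B) ⬝ᵥ Δ1 *ᵥ (h1Op K C Δ N D Qb *ᵥ B) + ab * (B ⬝ᵥ B) := by
  have hfeas := h1Op_feasible e K C Δ Q a hΔ hΔ' N hQN hQM hTs D Qb hW B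
  rw [G1inv_quadForm_gaugeFixed K C Δ Q a D Qb ab Δ1 h79 _ hfeas.2, hfeas.1]

/-- **THE HYPOTHESIS `h3156` OF `B12Eq15QuadraticForm.Data.eq15_eq_B9_3156` in the dictionary** («the first step of
(3.156)», `⟨H₁B, G₁⁻¹H₁B⟩ = ⟨B, (QG₁Q*)⁻¹B⟩`): the cell's `B9Eq3112.eq_3156_energy` at `K − 2C`, in the letter `h1Op`.
[cite: Balaban1985BackgroundPropagators, (3.156) p.428, (3.129) p.421] -/
theorem h1Op_energy [Fintype n] [Fintype m] [Fintype τ] [Fintype b] [Fintype q] [DecidableEq n] [DecidableEq m]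
    [DecidableEq τ] [DecidableEq b] [DecidableEq q] (e : n ≃ τ ⊕ m) (K C : Matrix b b ℝ) (Δ : Matrix n n ℝ)
    (Q : Matrix m n ℝ) (a : ℝ) (hΔ : Δ.IsSymm) (hΔ' : IsUnit (B9H163.Δ' Δ Q a)) (N : Matrix n τ ℝ)
    (hQN : Q * N = 0) (hQM : IsUnit (Q * Qᵀ).det) (hTs : IsUnit (Nᵀ * (Δ * Δ) * N).det) (D : Matrix b n ℝ)
    (hD : Dᵀ * D = Δ) (Qb : Matrix q b ℝ) (Dbar : Matrix q m ℝ) (h115 : Qb * D = Dbar * Q) (ab : ℝ)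
    (hW : IsUnit (kkt (K - (2 : ℝ) • C) (dcon Δ N D Qb)).det) (hG : IsUnit (G1inv K C Δ Q a D Qb ab).det)
    (hP : IsUnit (Qb * (G1inv K C Δ Q a D Qb ab)⁻¹ * Qbᵀ).det) (B : q → ℝ) :
    (h1Op K C Δ N D Qb *ᵥ B) ⬝ᵥ G1inv K C Δ Q a D Qb ab *ᵥ (h1Op K C Δ N D Qb *ᵥ B) =
      B ⬝ᵥ (Qb * (G1inv K C Δ Q a D Qb ab)⁻¹ * Qbᵀ)⁻¹ *ᵥ B :=
  B9Eq3112.eq_3156_energy e (K - (2 : ℝ) • C) Δ Q a hΔ hΔ' N hQN hQM hTs D hD Qb Dbar h115 ab hW hG hP B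

end SectDIdentities

section Exponent55

open B10SectCExpansion (ExpansionData QuadForm54 Expansion53 Vtilde53)

variable {q b n m τ σ : Type*} [Fintype q] [Fintype b] [DecidableEq q] [DecidableEq b]

/-- **p. 269 after (54): «Denoting the expression in curly brackets {⋯} in (53) by Ṽ(A), using the definition
(3.155) [5], … we obtain (55)»** — the exponent `A^η(U_k(⋯)) = A^η(U_{k+1}) + ½⟨A, Δ_kA⟩ + Ṽ(A)` ON THE CONCRETE
CARRIER with `Δ_k` := (3.156): r07's `B10SectCExpansion.expansion53_54` fed by `quadForm54_b9_of_Δa` (the third member of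
(53), `Expansion53 d S`, is the input — derived for such data modulo [7]'s located statements in
`B10Eq19LinearTerm.expansion53_of_minimality`). [cite: Balaban1985UV3, (53)-(55) p.269]
[cite: Balaban1985BackgroundPropagators, (3.156) p.428] -/
theorem exponent55_b9 [Fintype n] [Fintype m] [Fintype τ] [Fintype σ] [DecidableEq n] [DecidableEq m]
    [DecidableEq τ] [DecidableEq σ] (eS : b ≃ σ ⊕ (q ⊕ τ)) (e : n ≃ τ ⊕ m) (K C : Matrix b b ℝ) (hK : Kᵀ = K)
    (hC : Cᵀ = C) (Δ : Matrix n n ℝ) (Q : Matrix m n ℝ) (a : ℝ) (hΔ : Δ.IsSymm)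
    (hΔ' : IsUnit (B9H163.Δ' Δ Q a)) (N : Matrix n τ ℝ) (hQN : Q * N = 0) (hQM : IsUnit (Q * Qᵀ).det)
    (hTs : IsUnit (Nᵀ * (Δ * Δ) * N).det) (D : Matrix b n ℝ) (hD : Dᵀ * D = Δ) (Qb : Matrix q b ℝ)
    (Dbar : Matrix q m ℝ) (h115 : Qb * D = Dbar * Q) (ab : ℝ) (hQbM : IsUnit (Qb * Qbᵀ).det)
    (hΔa : (K - (2 : ℝ) • C + D * B9H163.R Δ Q a * Dᵀ + ab • (Qbᵀ * Qb)).PosDef) (NS : Matrix b σ ℝ)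
    (hSN : dcon Δ N D Qb * NS = 0) (hNSA : IsUnit (NSᵀ * NS).det) (Δ1 : Matrix b b ℝ)
    (h79 : ∀ A' : b → ℝ, B9H163.R Δ Q a *ᵥ (Dᵀ *ᵥ A') = 0 →
      A' ⬝ᵥ Δ1 *ᵥ A' = A' ⬝ᵥ K *ᵥ A' - 2 * (A' ⬝ᵥ C *ᵥ A'))
    (E : Matrix q q ℝ) (d : ExpansionData (EuclideanSpace ℝ q) (EuclideanSpace ℝ b))
    (hH : d.H₁ = Matrix.toEuclideanLin (h1Op K C Δ N D Qb)) (hΔ1 : d.Δ₁ = Matrix.toEuclideanLin Δ1)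
    (hE : ∀ A : EuclideanSpace ℝ q, ⟪d.H₁ (d.D₂ A), d.J⟫ = WithLp.ofLp A ⬝ᵥ E *ᵥ WithLp.ofLp A)
    (S : Set (EuclideanSpace ℝ q)) (h53 : Expansion53 d S) :
    ∀ A ∈ S, d.actFl A = d.actK1
      + (1 / 2 : ℝ) * ⟪A, Matrix.toEuclideanLin (deltaK K C Δ Q a D Qb ab E) A⟫ + Vtilde53 d A :=
  B10SectCExpansion.expansion53_54 d S _ h53
    (quadForm54_b9_of_Δa eS e K C hK hC Δ Q a hΔ hΔ' N hQN hQM hTs D hD Qb Dbar h115 ab hQbM hΔa NS hSN hNSA Δ1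
      h79 E d hH hΔ1 hE)

end Exponent55

end Literature.MathematicalPhysics.QuantumFieldTheory.Balaban1983to89.B10Eq54QuadForm
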